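import Summits.BirchSwinnertonDyer.Rank1Residual.Additive.X4TamDefectLevelLoweringFromPrint
import Summits.BirchSwinnertonDyer.Rank1Residual.X4.KuriharaLevelLoweringOfMultiplicityOneMinus
import Literature.NumberTheory.EllipticCurves.NewformSymmSquareJ1728Hecke
import HarnessLib

/-!
# TAM-DEFECT₂ on the twist-good locus, ODD twists (`D < 0`): `BSD(E,p)` from published inputs + (MO⁻)(OLD⁻) on the twist's MINUS symbols (cell `b2b-bsdres`, seat additive-p4 gen 23, line V42, file K6)

HONEST FRAMING (verbatim, cell `b2b-bsdres`): the goal of the cell is to DELETE the COMBINATION-SHAPED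
residual classes for ALL analytic-rank `≤ 1` curves over `ℚ` — "full BSD formula for every rank `≤ 1`
curve in class `C`" assembled STRICTLY from published theorems — so that the rank-`≤ 1` remainder
becomes exactly the CONSTRUCTION-SHAPED classes, which are TYPED (missing-input Props), NOT attempted;
this is not "finishing BSD". This file: research-route KERNEL COMPOSITION, the `D < 0` twin of
`Additive/X4TamDefectLevelLoweringFromPrint.lean`; the displayed hypotheses (MO⁻)/(OLD⁻) are predicates
with parameters; nothing booked; X4 stays CONSTRUCTION-SHAPED.

## What is proved

For an ODD quadratic character `χ_D` (`D < 0`; e.g. `W₀ = E^{(−3)}` at `p = 3`, `E^{(−7)}`, `E^{(−15)}`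
at `p ≥ 5`) the twist identity of `Additive/QuadraticTwistNewform.lean` reads the plus symbol of `f_E`
on the MINUS symbol of `f₀ = f_{W₀}`: `[r]⁺_{f_E} = c₀ Σ_u (u/m)[r + u/m]⁻_{f₀}`
(`exists_rat_ratPlusSymbol_eq_twistSum_of_neg`). So the published inputs are displayed on the
`θ̄`-eigen MINUS subspace (file K5):

* `plusSymbolLevelLowersOver_of_jacobiTwist_of_multiplicityOneMinus` — (MO⁻) + (OLD⁻) on `f₀` at level
  `N₀` + the odd twist identity ⟹ `PlusSymbolLevelLowersOver E p f_E ι ℓ`;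
* `X4.bsdp_of_multiplicityOneMinus_twist_of_tamagawa_le_two_of_shaAn_unit_of_five_le` — THE END at
  `p ≥ 5` (10 of the 39 twist-good TAM-DEFECT₂ unit cells have `D < 0`), and the `p ≥ 3` tower twin
  CONDITIONAL on the announced Kim 2025 clause (at `p = 3`, 381 of the 463 LL-eligible twist-good
  TAM-DEFECT₂ unit cells have `D < 0`, 308 of them `D = −3`);
* `X4.bsdp_of_multiplicityOneMinus_quadraticTwist_of_neg_of_five_le` — the CENSUS SHAPE: the abstract
  twist data discharged from a geometric datum `C • W₀^{(d)} = E`, `d < 0`, by the tree's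
  `exists_rat_ratPlusSymbol_eq_twistSum_of_neg`, `norm_ratCast_eq_one_of_twist_of_neg` (Pal 2012 for
  `Ω⁻`, proved in the tree) and `lFunction_quadraticTwist_apply_of_good_or_mult`; displayed: the
  published facts, the numerals, `p`-integral minus symbols of `f₀`, and (MO⁻)(OLD⁻).

## References

* K. A. Ribet, Invent. Math. 100 (1990), Thm. 1.1, Thm. 5.2 (b). [cite: Ribet1990, Thm. 1.1 and Thm. 5.2 (b)]
* A. Pál, Canad. J. Math. 64 (2012), Thm. 3.2, Prop. 2.5, p. 1514. [cite: Pal2012, Thm. 3.2 with Prop. 2.5 and p. 1514 (Ω⁻)]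
* C.-H. Kim, Amer. J. Math. 148 (2026), Thm. 1.9 (6), Conj. 1.10. [cite: Kim2022StructureSelmer, Thm. 1.9 (6) and Conj. 1.10]
-/

noncomputable section

open scoped MatrixGroups ModularForm NumberTheorySymbols

open CongruenceSubgroup Finset IsDedekindDomain NumberField

open Literature.NumberTheory.EllipticCurves Literature.NumberTheory.EllipticCurves.ModularForms
  Summit.BirchSwinnertonDyer.Rank1Residual.LevelLowering

namespace Summit.BirchSwinnertonDyer.Rank1Residual.Additive

variable {k : Type*} [CommRing k] (p : ℕ) [hp : Fact p.Prime] (ι : ZMod p →+* k)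
  (W : WeierstrassCurve ℚ) [W.IsGloballyMinimal] {m : ℕ} [NeZero m] {N₀ NW : ℕ} [NeZero N₀]
  {f₀ : CuspForm (Gamma0 N₀) 2} (fW : CuspForm (Gamma0 NW) 2)

/-- **THE CERTIFICATE OF THE ADDITIVE CURVE FROM (MO⁻) + (OLD⁻) ON ITS ODD TWIST.** As
`plusSymbolLevelLowersOver_of_jacobiTwist_of_multiplicityOne` with the twist identity on the MINUS
symbols of `f₀` (`hsym`, `D < 0` case), `Ω⁻_{f₀} ≠ 0`, `p`-integral minus symbols, and the displayed
inputs (MO⁻) `ModPMultiplicityOneMinus k N₀ θ̄`, (OLD⁻) `HasOldEigenMinusSymb k N₀ θ̄ ℓ w μ`.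
[cite: Ribet1990, Thm. 1.1 and Thm. 5.2 (b)] [cite: Kim2022StructureSelmer, §1.2.2 and §1.4.3] -/
theorem plusSymbolLevelLowersOver_of_jacobiTwist_of_multiplicityOneMinus (hmN : m ∣ W.conductorNorm ℤ)
    (hf₀ : IsNewform0 f₀) (hQ : coeffField f₀ = ⊥) (hΩ : minusPeriod f₀ ≠ 0)
    (hint : ∀ x : ℚ, ¬ p ∣ (ratMinusSymbol f₀ x).den)
    (θ : ℕ → ℤ) (hθ : ∀ q : ℕ, q.Prime → ((θ q : ℤ) : ℂ) = cuspCoeff f₀ q)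
    (hθW : ∀ q : ℕ, Kato.IsKolyvaginPrime W p 1 q →
      ((θ q : ℤ) : ZMod p) = ((J((q : ℤ) | m) : ℤ) : ZMod p) * (W.frobeniusTrace q : ZMod p))
    (c₀ : ℚ) (hc : ¬ p ∣ c₀.den)
    (hsym : ∀ r : ℚ, ratPlusSymbol fW r =
      c₀ * ∑ u : ZMod m, (J((u.val : ℤ) | m) : ℚ) * ratMinusSymbol f₀ (r + (u.val : ℚ) / m))
    (hMO : ModPMultiplicityOneMinus k N₀ (fun q ↦ ι ((θ q : ℤ) : ZMod p)))
    {ℓ : ℕ} {w : k} {μ : ℚ → k} (hℓ : ℓ.Coprime m)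
    (hOLD : HasOldEigenMinusSymb k N₀ (fun q ↦ ι ((θ q : ℤ) : ZMod p)) ℓ w μ) (hμ : IsPeriodic μ)
    (hH : ∀ q : ℕ, Kato.IsKolyvaginPrime W p 1 q → HeckeRel μ q (ι ((θ q : ℤ) : ZMod p)))
    (hw : w * ι ((J((ℓ : ℤ) | m) : ℤ) : ZMod p) = 1) :
    PlusSymbolLevelLowersOver W p fW ι ℓ := by
  obtain ⟨μ', hμ', hH', hV'⟩ := exists_oldShapeMinus_of_multiplicityOne_twist (ι := ι) hf₀ hQ hΩ hint
    θ hθ hMO hOLD hμ (P := Kato.IsKolyvaginPrime W p 1) hH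
  refine plusSymbolLevelLowersOver_of_jacobiTwistFn p ι W fW hmN (fun x ↦ ratMinusSymbol f₀ x) c₀ hc
    hint hsym hμ' hℓ hV' hw fun q hq ↦ ?_
  have h := hH' q hq
  rwa [hθW q hq, map_mul] at h

end Summit.BirchSwinnertonDyer.Rank1Residual.Additive

namespace Summit.BirchSwinnertonDyer.Rank1Residual.X4

open Complex WeierstrassCurve Literature.NumberTheory.EllipticCurves.Rank1Residual
  Literature.NumberTheory.EllipticCurves.Rank1Residual.Typed
  Summit.BirchSwinnertonDyer.Rank1Residual.LevelLowering Summit.BirchSwinnertonDyer.Rank1Residual.Additive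

variable {k : Type*} [CommRing k] [Nontrivial k]
  (W : WeierstrassCurve ℚ) [W.IsElliptic] [W.IsGloballyMinimal] (p : ℕ) [Fact p.Prime]
  (ι : ZMod p →+* k)

/-- **TAM-DEFECT₂ ON THE TWIST-GOOD LOCUS, ODD TWIST, `p ≥ 5`: `BSD(E,p)`** from Kim 2026 Thm. 1.8 (6) +
Cassels–Tate + GZK + modularity (PUBLISHED), the per-row numerals, the odd twist identity on the MINUS
symbols of `f₀`, and (MO⁻)(OLD⁻) ON `f₀` (in print when `p ∤ 2N₀`). Twin of
`bsdp_of_multiplicityOne_twist_of_tamagawa_le_two_of_shaAn_unit_of_five_le`. Nothing booked.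
[cite: Kim2022StructureSelmer, Thm. 1.9 (6) and Conj. 1.10 (PDF p. 8)] [cite: SilvermanAEC2009, Thm. X.4.14]
[cite: Ribet1990, Thm. 1.1 and Thm. 5.2 (b)] [cite: Miller2011LMS, §1 and Def. 1.1] -/
theorem bsdp_of_multiplicityOneMinus_twist_of_tamagawa_le_two_of_shaAn_unit_of_five_le
    (hKimk : Kim2026.rankZero_le_padicValNat_sha_of_kuriharaNumber_ne_zero)
    (hE67c : Kim2026.rankZero_padicValNat_sha_add_le_of_forall_pow_dvd_kuriharaNumber_cyclicLevel)
    (hCT : exists_casselsTate_pairing (K := ℚ))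
    (hGZK : rank_eq_analyticRank_of_analyticRank_le_one) (hmod : hasEntireLFunction_rat)
    (hp : 5 ≤ p) (hr : W.analyticRank = 0) (hsurj : W.HasSurjectiveModNGaloisRep p)
    {N : ℕ} [NeZero N] (D : ModularParametrizationData W N) (hN : W.conductorNorm ℤ = N)
    (hc : ¬ (p : ℤ) ∣ D.maninConstant)
    (hper : ∃ u : ℚ, ‖(u : ℚ_[p])‖ = 1 ∧ W.realPeriodRat = u * plusPeriod D.f)
    {q' : ℚ} (hq' : shaAn W = (q' : ℂ)) (hv : padicValRat p q' = 0)
    (hc2 : padicValNat p W.tamagawaProduct ≤ 2)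
    {m : ℕ} [NeZero m] (hmN : m ∣ W.conductorNorm ℤ) {N₀ : ℕ} [NeZero N₀] {f₀ : CuspForm (Gamma0 N₀) 2}
    (hf₀ : IsNewform0 f₀) (hQ : coeffField f₀ = ⊥) (hΩ : minusPeriod f₀ ≠ 0)
    (hint : ∀ x : ℚ, ¬ p ∣ (ratMinusSymbol f₀ x).den)
    (θ : ℕ → ℤ) (hθ : ∀ q : ℕ, q.Prime → ((θ q : ℤ) : ℂ) = cuspCoeff f₀ q)
    (hθW : ∀ q : ℕ, Kato.IsKolyvaginPrime W p 1 q →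
      ((θ q : ℤ) : ZMod p) = ((J((q : ℤ) | m) : ℤ) : ZMod p) * (W.frobeniusTrace q : ZMod p))
    (c₀ : ℚ) (hc₀ : ¬ p ∣ c₀.den)
    (hsym : ∀ r : ℚ, ratPlusSymbol D.f r =
      c₀ * ∑ u : ZMod m, (J((u.val : ℤ) | m) : ℚ) * ratMinusSymbol f₀ (r + (u.val : ℚ) / m))
    (hMO : ModPMultiplicityOneMinus k N₀ (fun q ↦ ι ((θ q : ℤ) : ZMod p)))
    {ℓ : ℕ} {w : k} {μ : ℚ → k} (hℓN : ℓ ∣ W.conductorNorm ℤ) (hℓ : ℓ.Coprime m)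
    (hOLD : HasOldEigenMinusSymb k N₀ (fun q ↦ ι ((θ q : ℤ) : ZMod p)) ℓ w μ) (hμ : IsPeriodic μ)
    (hH : ∀ q : ℕ, Kato.IsKolyvaginPrime W p 1 q → HeckeRel μ q (ι ((θ q : ℤ) : ZMod p)))
    (hw : w * ι ((J((ℓ : ℤ) | m) : ℤ) : ZMod p) = 1) : BSDp W p :=
  bsdp_of_plusSymbolLevelLowersOver_of_tamagawa_le_two_of_shaAn_unit_of_five_le W p hKimk hE67c hCT
    hGZK hmod hp hr hsurj D hN hc hper hq' hv
    (plusSymbolLevelLowersOver_of_jacobiTwist_of_multiplicityOneMinus p ι W D.f hmN hf₀ hQ hΩ hint θ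
      hθ hθW c₀ hc₀ hsym hMO hℓ hOLD hμ hH hw) hℓN hc2

/-- **The `p ≥ 3` tower twin (odd twist), CONDITIONAL on the announced Kim 2025 clause** — at `p = 3`
the `E^{(−3)}`-type part of the N11 TAM-DEFECT₂(3) block. [claim: Kim2025RefinedTNC, status: under-review]
[cite: Kim2025RefinedTNC, Thm. 1.1 ("BSD") (ANNOUNCED, OPEN binder)] [cite: Ribet1990, Thm. 1.1 and Thm. 5.2 (b)]
[cite: SilvermanAEC2009, Thm. X.4.14] [cite: Miller2011LMS, §1 and Def. 1.1] -/
theorem bsdp_of_multiplicityOneMinus_twist_of_tamagawa_le_two_of_shaAn_unit_of_kim2025_OPEN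
    (hK25s : Kim2025.thm11_kimShaLength_of_integralPeriod_OPEN)
    (hCT : exists_casselsTate_pairing (K := ℚ))
    (hGZK : rank_eq_analyticRank_of_analyticRank_le_one) (hmod : hasEntireLFunction_rat)
    (hp3 : 3 ≤ p) (hr : W.analyticRank = 0) (htower : ∀ n : ℕ, W.HasSurjectiveModNGaloisRep (p ^ n : ℕ))
    {N : ℕ} [NeZero N] (D : ModularParametrizationData W N) (hN : W.conductorNorm ℤ = N)
    (hper : ∃ u : ℚ, ‖(u : ℚ_[p])‖ = 1 ∧ W.realPeriodRat = u * plusPeriod D.f)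
    {q' : ℚ} (hq' : shaAn W = (q' : ℂ)) (hv : padicValRat p q' = 0)
    (hc2 : padicValNat p W.tamagawaProduct ≤ 2)
    {m : ℕ} [NeZero m] (hmN : m ∣ W.conductorNorm ℤ) {N₀ : ℕ} [NeZero N₀] {f₀ : CuspForm (Gamma0 N₀) 2}
    (hf₀ : IsNewform0 f₀) (hQ : coeffField f₀ = ⊥) (hΩ : minusPeriod f₀ ≠ 0)
    (hint : ∀ x : ℚ, ¬ p ∣ (ratMinusSymbol f₀ x).den)
    (θ : ℕ → ℤ) (hθ : ∀ q : ℕ, q.Prime → ((θ q : ℤ) : ℂ) = cuspCoeff f₀ q)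
    (hθW : ∀ q : ℕ, Kato.IsKolyvaginPrime W p 1 q →
      ((θ q : ℤ) : ZMod p) = ((J((q : ℤ) | m) : ℤ) : ZMod p) * (W.frobeniusTrace q : ZMod p))
    (c₀ : ℚ) (hc₀ : ¬ p ∣ c₀.den)
    (hsym : ∀ r : ℚ, ratPlusSymbol D.f r =
      c₀ * ∑ u : ZMod m, (J((u.val : ℤ) | m) : ℚ) * ratMinusSymbol f₀ (r + (u.val : ℚ) / m))
    (hMO : ModPMultiplicityOneMinus k N₀ (fun q ↦ ι ((θ q : ℤ) : ZMod p)))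
    {ℓ : ℕ} {w : k} {μ : ℚ → k} (hℓN : ℓ ∣ W.conductorNorm ℤ) (hℓ : ℓ.Coprime m)
    (hOLD : HasOldEigenMinusSymb k N₀ (fun q ↦ ι ((θ q : ℤ) : ZMod p)) ℓ w μ) (hμ : IsPeriodic μ)
    (hH : ∀ q : ℕ, Kato.IsKolyvaginPrime W p 1 q → HeckeRel μ q (ι ((θ q : ℤ) : ZMod p)))
    (hw : w * ι ((J((ℓ : ℤ) | m) : ℤ) : ZMod p) = 1) : BSDp W p :=
  bsdp_of_plusSymbolLevelLowersOver_of_tamagawa_le_two_of_shaAn_unit_of_kim2025_OPEN W p hK25s hCT hGZK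
    hmod hp3 hr htower D hN hper hq' hv
    (plusSymbolLevelLowersOver_of_jacobiTwist_of_multiplicityOneMinus p ι W D.f hmN hf₀ hQ hΩ hint θ
      hθ hθW c₀ hc₀ hsym hMO hℓ hOLD hμ hH hw) hℓN hc2

/-- **TAM-DEFECT₂ ON THE TWIST-GOOD LOCUS (census shape, `d < 0`).** `E = W` globally minimal with
`C • W₀^{(d)} = E` for a square-free `d ≡ 1 (mod 4)`, `d < 0`, `W₀` globally minimal and good or
multiplicative at the primes dividing `d`; `p ≥ 5`, `r_an(E) = 0`, `ρ̄_{E,p}` onto, a conductor-level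
datum with `p ∤ c_D` and the period transfer, `#Ш_an(E)` a `p`-unit, `ord_p ∏ c_v(E) ≤ 2`; the newform
`f₀` of `W₀` at a level `N₀ ∣ N` with `d² ∣ N`, `|d| ∣ N`, the IMAGINARY period transfer for `W₀` and
`p`-integral minus symbols of `f₀`; and (MO⁻)(OLD⁻) on the `θ̄_{W₀}`-eigen MINUS subspace at a prime
`ℓ ∣ N` coprime to `d` with `w·ι((ℓ/|d|)) = 1` — IN PRINT when `p ∤ 2N₀`. THEN **`BSD(E,p)`** from
Kim 2026 Thm. 1.8 (6) + Cassels–Tate + GZK + modularity (PUBLISHED) and tree theorems. Nothing booked.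
[cite: Kim2022StructureSelmer, Thm. 1.9 (6) and Conj. 1.10 (PDF p. 8)] [cite: Ribet1990, Thm. 1.1 and Thm. 5.2 (b)]
[cite: Pal2012, Thm. 3.2 with Prop. 2.5 and p. 1514 (Ω⁻)] [cite: SilvermanAEC2009, Thm. X.4.14]
[cite: Miller2011LMS, §1 and Def. 1.1] -/
theorem bsdp_of_multiplicityOneMinus_quadraticTwist_of_neg_of_five_le
    (W₀ : WeierstrassCurve ℚ) [W₀.IsElliptic] [W₀.IsGloballyMinimal]
    (hKimk : Kim2026.rankZero_le_padicValNat_sha_of_kuriharaNumber_ne_zero)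
    (hE67c : Kim2026.rankZero_padicValNat_sha_add_le_of_forall_pow_dvd_kuriharaNumber_cyclicLevel)
    (hCT : exists_casselsTate_pairing (K := ℚ))
    (hGZK : rank_eq_analyticRank_of_analyticRank_le_one) (hmod : hasEntireLFunction_rat)
    (hp : 5 ≤ p) (hr : W.analyticRank = 0) (hsurj : W.HasSurjectiveModNGaloisRep p)
    {N : ℕ} [NeZero N] (D : ModularParametrizationData W N) (hN : W.conductorNorm ℤ = N)
    (hc : ¬ (p : ℤ) ∣ D.maninConstant)
    (hper : ∃ u : ℚ, ‖(u : ℚ_[p])‖ = 1 ∧ W.realPeriodRat = u * plusPeriod D.f)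
    {q' : ℚ} (hq' : shaAn W = (q' : ℂ)) (hv : padicValRat p q' = 0)
    (hc2 : padicValNat p W.tamagawaProduct ≤ 2)
    {d : ℤ} (hd4 : d % 4 = 1) (hsq : Squarefree d) (hd : d < 0) (C : VariableChange ℚ)
    (hC : C • W₀.quadraticTwist (d : ℚ) = W)
    (hgm : ∀ v : HeightOneSpectrum (𝓞 ℚ), ((Rat.HeightOneSpectrum.primesEquiv v : ℕ) : ℤ) ∣ d →
      W₀.HasGoodReductionAt v ∨ W₀.HasMultiplicativeReductionAt v)
    {N₀ : ℕ} [NeZero N₀] [NeZero d.natAbs] {f₀ : CuspForm (Gamma0 N₀) 2} (hf₀ : IsNewformOf W₀ f₀)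
    (hN₀ : N₀ ∣ N) (hm : d.natAbs ^ 2 ∣ N) (hmN : d.natAbs ∣ W.conductorNorm ℤ)
    (hper₀ : ∃ u : ℚ, ‖(u : ℚ_[p])‖ = 1 ∧ W₀.imaginaryPeriodRat = u * minusPeriod f₀)
    (hint : ∀ x : ℚ, ¬ p ∣ (ratMinusSymbol f₀ x).den)
    (hMO : ModPMultiplicityOneMinus k N₀ (fun q ↦ ι ((W₀.LFunction q : ℤ) : ZMod p)))
    {ℓ : ℕ} {w : k} {μ : ℚ → k} (hℓN : ℓ ∣ W.conductorNorm ℤ) (hℓ : ℓ.Coprime d.natAbs)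
    (hOLD : HasOldEigenMinusSymb k N₀ (fun q ↦ ι ((W₀.LFunction q : ℤ) : ZMod p)) ℓ w μ)
    (hμ : IsPeriodic μ)
    (hH : ∀ q : ℕ, Kato.IsKolyvaginPrime W p 1 q → HeckeRel μ q (ι ((W₀.LFunction q : ℤ) : ZMod p)))
    (hw : w * ι ((J((ℓ : ℤ) | d.natAbs) : ℤ) : ZMod p) = 1) : BSDp W p := by
  have hp2 : p ≠ 2 := by omega
  have hfW : IsNewformOf W D.f := D.isNewformOf
  have hQ : coeffField f₀ = ⊥ := hf₀.coeffField_eq_bot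
  have hΩ : minusPeriod f₀ ≠ 0 := (IsNewform0.exists_rat_smul_minusPeriod_holds hf₀.1 hQ).1
  have hadd := hasAdditiveReductionAt_quadraticTwist_of_good_or_mult W₀ hd4 hsq hgm
  obtain ⟨c₀, hc₀, hrel⟩ :=
    exists_rat_ratPlusSymbol_eq_twistSum_of_neg W₀ W hd4 hsq hd ⟨C, hC⟩ hadd hf₀ hfW hN₀ hm
  have hθW : ∀ q : ℕ, Kato.IsKolyvaginPrime W p 1 q → ((W₀.LFunction q : ℤ) : ZMod p) =
      ((J((q : ℤ) | d.natAbs) : ℤ) : ZMod p) * (W.frobeniusTrace q : ZMod p) := by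
    intro q hq
    have hqN : ¬ q ∣ N := fun h ↦ hq.not_dvd_conductorNorm (by rw [hN]; exact h)
    have htr : (W.LFunction q : ℂ) = (W.frobeniusTrace q : ℂ) := by
      rw [← hfW.2 q, IsNewformOf.cuspCoeff_eq_frobeniusTrace_of_not_dvd hfW hq.prime hqN]
    have hd0 : d ≠ 0 := by rintro rfl; norm_num at hd4
    haveI : (W₀.quadraticTwist (d : ℚ)).IsElliptic := W₀.isElliptic_quadraticTwist (by exact_mod_cast hd0)
    have hLW : W.LFunction q = (W₀.quadraticTwist (d : ℚ)).LFunction q := by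
      rw [← hC, LFunction_smul]
    have htr' : W.frobeniusTrace q = J((q : ℤ) | d.natAbs) * W₀.LFunction q := by
      have h1 : W.LFunction q = W.frobeniusTrace q := by exact_mod_cast htr
      rw [← h1, hLW, lFunction_quadraticTwist_apply_of_good_or_mult W₀ hd4 hsq hgm q]
    have hqm : q.Coprime d.natAbs :=
      (Nat.Prime.coprime_iff_not_dvd hq.prime).mpr fun hdv ↦
        hq.not_dvd_conductorNorm ((hdv.trans hmN))
    have hJ : ((J((q : ℤ) | d.natAbs) : ℤ) : ZMod p) ^ 2 = 1 := by
      rw [← jacobiHom_natCast p, jacobiHom_natCast_sq_eq_one p hqm]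
    rw [htr']
    push_cast
    linear_combination -(((W₀.LFunction q : ℤ) : ZMod p)) * hJ
  by_cases hex : ∃ r : ℚ, ∑ u : ZMod d.natAbs, (J((u.val : ℤ) | d.natAbs) : ℚ) *
      ratMinusSymbol f₀ (r + (u.val : ℚ) / d.natAbs) ≠ 0
  · obtain ⟨uW, huW, hΩW⟩ := hper
    obtain ⟨u₀, hu₀, hΩ₀⟩ := hper₀
    have hunit : ‖(c₀ : ℚ_[p])‖ = 1 :=
      norm_ratCast_eq_one_of_twist_of_neg p W₀ W hp2 hd4 hsq hd C hC hgm huW hu₀ hΩW hΩ₀ (hrel hex)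
    exact bsdp_of_multiplicityOneMinus_twist_of_tamagawa_le_two_of_shaAn_unit_of_five_le W p ι hKimk hE67c
      hCT hGZK hmod hp hr hsurj D hN hc ⟨uW, huW, hΩW⟩ hq' hv hc2 hmN hf₀.1 hQ hΩ hint
      (fun q ↦ W₀.LFunction q) (fun q _ ↦ (hf₀.2 q).symm) hθW c₀
      (not_dvd_den_of_norm_ratCast_le_one hunit.le) hc₀ hMO hℓN hℓ hOLD hμ hH hw
  · simp only [not_exists, not_not] at hex
    have hcert : PlusSymbolLevelLowersOver W p D.f ι ℓ :=
      ⟨0, fun _ _ ↦ rfl, fun q _ r ↦ by simp, fun r ↦ by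
        rw [hc₀ r, hex r, mul_zero, Rat.cast_zero, map_zero, Pi.zero_apply, Pi.zero_apply, sub_zero]⟩
    exact bsdp_of_plusSymbolLevelLowersOver_of_tamagawa_le_two_of_shaAn_unit_of_five_le W p hKimk hE67c hCT
      hGZK hmod hp hr hsurj D hN hc hper hq' hv hcert hℓN hc2

end Summit.BirchSwinnertonDyer.Rank1Residual.X4

end
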